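import Mathlib
import Literature.AlgebraicGeometry.Resolution.DefectlessDedekind
import Literature.AlgebraicGeometry.Resolution.SeparablyDefectlessRationalVTProofs
import Literature.AlgebraicGeometry.Resolution.ValuationDefectProofs
import Summits.ResolutionOfSingularities.ResolutionOfSingularities.Theorems.DefectlessFramesDefectlessFramesRDefectTail

/-!
# Discrete places: `K/k(y')` is defectless at a DVR (stub `stub_dfrDiscrete`)

Crux `DefectlessFramesR`, line `Sketch`. Let `O ⊇ k` be a valuation ring of the function field `K/k`
which is a discrete valuation ring, `y' : Fin n → O` and `z' ∈ O` separable over `F' = k(y')` with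
`K = k(y', z')`. For an algebraic closure `Ω ⊇ K`, a valuation ring `V` of `Ω` over `O`, `F = k(y') ⊆ Ω`
(the image of `F'`) and its henselization `F^h`, we prove that `F^h · K = F^h(z')` is a defectless
extension of `F^h` (`IsDefectlessExtension`):

* `W = O ∩ F'` is the valuation ring of the restriction to `F'` of the normalised discrete valuation
  `K → ℤ ∪ {∞}` of `O`; its value group is a non-trivial subgroup of `ℤ` (`K/F'` is algebraic and a DVR
  is not a field), so `W` is again a discrete valuation ring (Serre, *Local Fields*, I §1, Prop. 1 =
  Mathlib's `Valuation.valuationSubring_isDiscreteValuationRing`)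
  (`dfrDiscrete_isSeparablyDefectlessField_comap`);
* a discrete valuation ring is separably defectless: it is a Dedekind domain whose integral closure in
  a finite separable extension is finite (`IsIntegralClosure.finite`), so `∑ eᵢ fᵢ = n`
  (`isDefectlessIn_of_finite_integralClosure`) (`dfrDiscrete_isSeparablyDefectlessField_valuationSubring`);
* separable defectlessness is transported along `F' ≅ F` (`IsSeparablyDefectlessField.congr`) and the
  shared tail `stub_dfrDefectTail` (henselization henselian and separably defectless, `F^h(z')/F^h`
  finite separable) gives `[F^h(z') : F^h] = e · f`.
-/

namespace Summit.ResolutionOfSingularities.ResolutionOfSingularities.Theorems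

open IsLocalRing Literature.AlgebraicGeometry.Resolution

universe u

/-- **The valuation ring of a non-trivial `ℤ`-valued valuation of a field is separably defectless**:
it is a discrete valuation ring (Serre, *Local Fields*, I §1, Prop. 1), hence a Dedekind domain with
finite integral closure in every finite separable extension, in which therefore `∑ eᵢ fᵢ = n`.
[folklore] -/
theorem dfrDiscrete_isSeparablyDefectlessField_valuationSubring {E : Type u} [Field E]
    (w : Valuation E (WithZero (Multiplicative ℤ))) [w.IsNontrivial] :
    IsSeparablyDefectlessField E w.valuationSubring := by
  intro L _ _ hfin hsep
  haveI := hfin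
  haveI := hsep
  letI : Algebra w.valuationSubring L :=
    ((algebraMap E L).comp (algebraMap w.valuationSubring E)).toAlgebra
  haveI : IsScalarTower w.valuationSubring E L := IsScalarTower.of_algebraMap_eq fun _ => rfl
  haveI : Module.Finite w.valuationSubring (integralClosure w.valuationSubring L) :=
    IsIntegralClosure.finite w.valuationSubring E L (integralClosure w.valuationSubring L)
  have hne : w.valuationSubring ≠ ⊤ := fun h =>
    (Valuation.valuationSubring_eq_top_iff w).mp h inferInstance
  obtain ⟨v, hv⟩ := exists_eq_valuationSubringAtPrime_of_le (A := w.valuationSubring)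
    w.valuationSubring (fun a => a.2) hne
  rw [← hv]
  exact isDefectlessIn_of_finite_integralClosure v

/-- **Restricting a discrete valuation along an algebraic extension keeps it separably defectless.**
If `O` is a discrete valuation ring of `K` and `K/E` is algebraic, then `(E, O ∩ E)` is a separably
defectless valued field: `O ∩ E` is the valuation ring of the restriction to `E` of the normalised
discrete valuation of `O`, which is non-trivial on `E` (a valuation ring of `K` containing `E` would be
all of `K`, but a DVR is not a field). [folklore] -/
theorem dfrDiscrete_isSeparablyDefectlessField_comap {E K : Type u} [Field E] [Field K]
    [Algebra E K] [Algebra.IsAlgebraic E K] (O : ValuationSubring K)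
    [IsDiscreteValuationRing O] : IsSeparablyDefectlessField E (O.comap (algebraMap E K)) := by
  -- the normalised discrete valuation of `K` with valuation ring `O`, and its restriction to `E`
  let vK : Valuation K (WithZero (Multiplicative ℤ)) :=
    (IsDiscreteValuationRing.maximalIdeal O).valuation K
  have hOv : ∀ x : K, vK x ≤ 1 ↔ x ∈ O := fun x =>
    ⟨fun h => by
      obtain ⟨a, ha⟩ := IsDiscreteValuationRing.exists_lift_of_le_one h
      rw [← ha]
      exact a.2,
     fun hx => IsDedekindDomain.HeightOneSpectrum.valuation_le_one _ (⟨x, hx⟩ : O)⟩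
  let w : Valuation E (WithZero (Multiplicative ℤ)) := vK.comap (algebraMap E K)
  have hwO : w.valuationSubring = O.comap (algebraMap E K) := by
    ext x
    exact hOv (algebraMap E K x)
  have hne : O.comap (algebraMap E K) ≠ ⊤ := fun htop => by
    obtain ⟨ϖ, hϖ⟩ := IsDiscreteValuationRing.exists_irreducible O
    have hOtop := valuationSubring_eq_top_of_comap_eq_top E O htop
    have hϖ0 : (ϖ : K) ≠ 0 := fun h => hϖ.ne_zero (Subtype.ext h)
    have hinv : (ϖ : K)⁻¹ ∈ O := hOtop.ge (ValuationSubring.mem_top _)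
    exact hϖ.not_isUnit (IsUnit.of_mul_eq_one (⟨_, hinv⟩ : O) (Subtype.ext (mul_inv_cancel₀ hϖ0)))
  haveI : w.IsNontrivial := by
    by_contra h
    exact hne (hwO ▸ (Valuation.valuationSubring_eq_top_iff w).mpr h)
  rw [← hwO]
  exact dfrDiscrete_isSeparablyDefectlessField_valuationSubring w

/-- **Discrete places** (stub `stub_dfrDiscrete` of crux `DefectlessFramesR`, line `Sketch`). If the
valuation ring `O ⊇ k` of `K` is a discrete valuation ring, then for `y' : Fin n → O` and `z' ∈ O`
separable over `k(y')` with `k(y', z') = K`, the projection `K/k(y')` is defectless at `O`: for every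
valuation ring `V` over `O` of an algebraic closure `Ω ⊇ K`, with `F = k(y') ⊆ Ω` and `F^h` its
henselization, `F^h · K = F^h(z')` is a defectless extension of `F^h`. Indeed `O ∩ k(y')` is again a
discrete valuation ring, hence separably defectless (finite integral closure in separable extensions),
and separable defectlessness passes to the henselian field `F^h`, over which `F^h(z')` is finite
separable (`stub_dfrDefectTail`). [folklore] -/
theorem stub_dfrDiscrete : ∀ p : ℕ, p.Prime → ∀ (k K : Type) [Field k] [CharP k p] [PerfectField k] [Field K] [Algebra k K], (⊤ : IntermediateField k K).FG → ∀ O : ValuationSubring K, ∀ hk : (∀ c : k, algebraMap k K c ∈ O), Nonempty O.valuation.RankOne → (∀ x ∈ O, ∃ f : Polynomial k, f ≠ 0 ∧ Polynomial.aeval x f ∈ O.nonunits) → IsDiscreteValuationRing O → ∀ (n : ℕ) (y' : Fin n → O) (z' : O), AlgebraicIndependent k (fun i => (y' i : K)) → IsIntegral (Algebra.adjoin k (Set.range fun i => (y' i : K))) (z' : K) → IntermediateField.adjoin k (Set.range (fun i => (y' i : K)) ∪ {(z' : K)}) = ⊤ → IsSeparable (IntermediateField.adjoin k (Set.range fun i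 => (y' i : K))) (z' : K) → ∀ (Ω : Type) [Field Ω] [Algebra K Ω] [IsAlgClosure K Ω] (V : ValuationSubring Ω), V.comap (algebraMap K Ω) = O → let F : Subfield Ω := (IntermediateField.adjoin k (Set.range fun i => (y' i : K))).toSubfield.map (algebraMap K Ω); Literature.AlgebraicGeometry.Resolution.IsDefectlessExtension V (Literature.AlgebraicGeometry.Resolution.henselization V F) (Literature.AlgebraicGeometry.Resolution.henselization V F ⊔ (algebraMap K Ω).fieldRange) := by
  intro p _hp k K _ _ _ _ _ _hfg O _hk _hR _hZ hdvr n y' z' _hy _hint hadj hsep Ω _ _ _ V hVO F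
  haveI : IsAlgClosed Ω := IsAlgClosure.isAlgClosed K
  subst hVO
  haveI : IsDiscreteValuationRing (V.comap (algebraMap K Ω)) := hdvr
  -- the field `F' = k(y') ≤ K` and its isomorphic image `F ≤ Ω`
  set F' : IntermediateField k K := IntermediateField.adjoin k (Set.range fun i => (y' i : K))
    with hF'def
  have hFmem : ∀ x : K, x ∈ F' → algebraMap K Ω x ∈ F := fun x hx => Subfield.mem_map.mpr ⟨x, hx, rfl⟩
  let f : F' →+* F := ((algebraMap K Ω).comp (algebraMap F' K)).codRestrict F fun x => hFmem x x.2
  have hf : Function.Bijective f := by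
    refine ⟨fun a b h => Subtype.ext ((algebraMap K Ω).injective (congrArg Subtype.val h)),
      fun w => ?_⟩
    obtain ⟨x, hx, hxw⟩ := Subfield.mem_map.mp w.2
    exact ⟨⟨x, hx⟩, Subtype.ext hxw⟩
  -- `K = F'(z')` is finite over `F'`
  have htop : IntermediateField.adjoin F' ({(z' : K)} : Set K) = ⊤ := by
    rw [← IntermediateField.restrictScalars_eq_top_iff (K := k), IntermediateField.adjoin_adjoin_left,
      hadj]
  haveI : FiniteDimensional F' K := by
    have h1 : FiniteDimensional F' (IntermediateField.adjoin F' ({(z' : K)} : Set K)) :=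
      IntermediateField.adjoin.finiteDimensional hsep.isIntegral
    rw [htop] at h1
    exact IntermediateField.topEquiv.toLinearEquiv.finiteDimensional
  -- `(F', O ∩ F')` is separably defectless, and so is its isomorphic image `(F, V ∩ F)`
  have hsdW : IsSeparablyDefectlessField F'
      ((V.comap (algebraMap K Ω)).comap (algebraMap F' K)) :=
    dfrDiscrete_isSeparablyDefectlessField_comap (V.comap (algebraMap K Ω))
  have hsdF : IsSeparablyDefectlessField F (V.comap (algebraMap F Ω)) := by
    refine IsSeparablyDefectlessField.congr (RingEquiv.ofBijective f hf) ?_ hsdW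
    ext x
    exact Iff.rfl
  -- the shared tail
  exact stub_dfrDefectTail k K n (fun i => (y' i : K)) (z' : K) hadj hsep Ω V hsdF

end Summit.ResolutionOfSingularities.ResolutionOfSingularities.Theorems
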